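import Summits.CriticalPhenomena.CardyFormulaZ2.Theorems.CardyComplexConeEdgePrecompactVertexRelation
import Summits.CriticalPhenomena.CardyFormulaZ2.Theorems.CardySusyWardParafermionPrecompactVertexRelationGeometry

/-!
# Kirchhoff's vertex relation for the spin-`1/3` corner observable (`stub_kirchhoff`)
(stub `stub_kirchhoff` of line `finitary-green-pairing`, crux `CoherentMorera`, stmt-CriticalPhenomena-11388)

The Duminil-Copin 2012 Prop. 4 / Duminil-Copin–Smirnov 2012 Prop. 8.6 vertex relation at `q = 1`,
chirality `χ = +i`: `E(NW) − E(SE) = i · (E(NE) − E(SW))` for the four corner observables at a lattice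
edge `s(x, x + eᵢ)`, in the family form of the line (`Sig.stub_kirchhoff`: for `Λ` with the crux guards
over a Jordan Dobrushin domain `D`, eventually as `δ → 0⁺`, at every edge whose medial point lies in a
fixed compact `K ⊆ D`).

The datum-form relation is the landed `cornerObs_vertexRelation` of the sibling crux `EdgePrecompact`
(line `qkz-strip-boundary-arm`, `Theorems/CardyComplexConeEdgePrecompactVertexRelation.lean`: edge-flip
involution `ω ↦ ω △ {e}` preserving `P_{1/2}`, Smirnov's three cases, and the planar input that the loop
spliced in at `e` turns by `4 · turnSign` on Jordan carriers).  This file supplies the geometry of the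
stub: a `2δ`-deep edge with a vertex in `Ω_δ` has all eight faces at its endpoints inner
(`faces_inner_of_ball` of line `kenyon-stream-second-relation`), hence is an edge of `Ω_δ` off the arcs;
a `2δ`-deep edge with vertex outside `Ω_δ` carries no dart of the exploration, so all four corner
observables vanish (`dartPhaseSum_eq_zero_of_not_isInnerFace`); the corner table `cornersAt` is read off
for the two orientations; and edges with medial point in `K` are `2δ`-deep once `2δ ≤ dist(K, ∂D)`.

References: H. Duminil-Copin, *Parafermionic observables and their applications*, arXiv:1208.3787,
Prop. 4; H. Duminil-Copin, S. Smirnov, Clay Math. Proc. 15 (2012), Prop. 8.6; S. Smirnov, Ann. of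
Math. 172 (2010), proof of Lemma 4.5.
-/

noncomputable section

namespace Summit.CriticalPhenomena.CardyFormulaZ2.Cruxes.CoherentMorera.FinitaryGreenPairing

open MeasureTheory Filter Set Metric
open scoped Topology
open Literature.Probability.LatticeModels Literature.Probability.Percolation
open Literature.Probability.RandomPlanarGeometry (DobrushinDomain)
open Summit.CriticalPhenomena.CardyFormulaZ2.Cruxes.ParafermionPrecompact.KenyonStreamSecondRelation
  (faces_inner_of_ball not_mem_zdBoundary_of_faces_inner dartPhaseSum_eq_zero_of_not_isInnerFace)

/-! ## The datum-form corner observable -/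

/-- The line's corner observable of the family `Λ` at mesh `δ` IS the datum-form corner observable of
the sibling crux `EdgePrecompact` for the datum `Λ δ` (definitional). -/
theorem cornerObs_eq_datum (Λ : ℝ → DiscreteDobrushin) (δ : ℝ) :
    cornerObs Λ δ = fun c => EdgePrecompact.QkzStripBoundaryArm.cornerObs (Λ δ) δ c.1 c.2 := rfl

/-- The datum-form corner observable vanishes at a corner whose face is not inner: the exploration
path only carries darts with inner faces. -/
theorem datumCornerObs_eq_zero_of_not_isInnerFace (E : DiscreteDobrushin) (δ : ℝ) (r : Site 2 × Fin 4)
    (hr : ¬ E.IsInnerFace (cFace r)) :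
    EdgePrecompact.QkzStripBoundaryArm.cornerObs E δ r.1 (cFace r) = 0 := by
  rw [EdgePrecompact.QkzStripBoundaryArm.cornerObs_eq_integral_dartPhaseSum]
  rw [show (fun ω => dartPhaseSum (medialExploration E ω) δ (1 / 3) (r.1, cFace r)) = fun _ => (0 : ℂ) from
    funext fun ω => dartPhaseSum_eq_zero_of_not_isInnerFace E ω δ (1 / 3) r hr, integral_zero]

/-! ## The datum form of the relation at a deep edge -/

/-- **Kirchhoff's relation at a `2δ`-deep edge of Jordan data (datum form).** For the admissible
discretisation `E` of a Jordan Dobrushin domain (`E.Ω = D.carrier`) and a lattice edge `s(x, x + eᵢ)`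
whose closed `2δ`-neighbourhood (about its medial point) lies in `E.Ω`:
`E(NW) − E(SE) = i · (E(NE) − E(SW))` for the datum-form corner observable at the four corners
`cornersAt x i`.  Either `x ∈ Ω_δ`, and all faces at both endpoints are inner, so the edge is an interior
edge of `Ω_δ` off the arcs and `cornerObs_vertexRelation` applies; or `x ∉ Ω_δ`, no face at `x` is
inner, and all four observables vanish. -/
theorem kirchhoffRel_datum (D : DobrushinDomain) {E : DiscreteDobrushin} (hΩ : E.Ω = D.carrier)
    (hE : E.IsZdAdmissible) (x : Site 2) (i : Fin 2)
    (hball : closedBall (medialPoint E.δ s(x, x + Pi.single i 1)) (2 * E.δ) ⊆ E.Ω) :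
    KirchhoffRel (fun c => EdgePrecompact.QkzStripBoundaryArm.cornerObs E E.δ c.1 c.2) x i := by
  -- interior case, for the in-dart `p` of a `2δ`-deep edge with vertex in `Ω_δ`
  have interior : ∀ p : Site 2 × Fin 4, p.1 ∈ meshDomain E.Ω E.δ →
      closedBall (medialPoint E.δ (cTgt p)) (2 * E.δ) ⊆ E.Ω →
      EdgePrecompact.QkzStripBoundaryArm.cornerObs E E.δ p.1 (cFace (p.1, p.2 + 1)) -
          EdgePrecompact.QkzStripBoundaryArm.cornerObs E E.δ (p.1 + cornerUnit (p.2 + 1))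
            (cFace (p.1 + cornerUnit (p.2 + 1), p.2 + 3)) =
        Complex.I * (EdgePrecompact.QkzStripBoundaryArm.cornerObs E E.δ (cornerPartner p).1 (cFace (cornerPartner p)) -
          EdgePrecompact.QkzStripBoundaryArm.cornerObs E E.δ p.1 (cFace p)) := by
    rintro ⟨v, k⟩ hvD hb
    obtain ⟨hx, hy⟩ := faces_inner_of_ball hE.delta_pos hvD hb
    have he : cTgt ((v, k) : Site 2 × Fin 4) ∈ (discreteDomainGraph E.Ω E.δ).edgeSet := by
      rw [cTgt, SimpleGraph.mem_edgeSet]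
      exact DiscreteDobrushin.adj_of_isInnerFace_faceAt (hx (k + 1)) (Or.inl rfl)
    have hAB : ∀ y ∈ cTgt ((v, k) : Site 2 × Fin 4), y ∉ E.zdArcA ∧ y ∉ E.zdArcB := by
      intro y hy'
      have hyb : y ∉ E.zdBoundary := by
        rw [cTgt] at hy'
        rcases Sym2.mem_iff.1 hy' with rfl | rfl
        · exact not_mem_zdBoundary_of_faces_inner hx
        · exact not_mem_zdBoundary_of_faces_inner hy
      exact ⟨fun h => hyb (E.zdArcA_subset_zdBoundary h), fun h => hyb (E.zdArcB_subset_zdBoundary h)⟩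
    exact EdgePrecompact.QkzStripBoundaryArm.cornerObs_vertexRelation D hΩ hE he hAB (hx k) (hx _)
  -- exterior case: at a vertex outside `Ω_δ` no face is inner and the observables vanish
  have exterior : x ∉ meshDomain E.Ω E.δ → ∀ r : Site 2 × Fin 4, (∃ j, cFace r = faceAt x j) →
      EdgePrecompact.QkzStripBoundaryArm.cornerObs E E.δ r.1 (cFace r) = 0 := fun hxD r ⟨j, hj⟩ =>
    datumCornerObs_eq_zero_of_not_isInnerFace E E.δ r
      (by rw [hj]; exact fun h => hxD (mem_meshDomain_of_isCorner_of_isInnerFace (isCorner_faceAt x j) h))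
  have f0 : faceAt x 0 = x := by simp [faceAt, cornerOff]
  fin_cases i
  · -- horizontal edge `s(x, x + e₀)`, in-dart `p = (x, 3)`: `NW, NE, SE, SW = oX, p₂, oY, p`
    show EdgePrecompact.QkzStripBoundaryArm.cornerObs E E.δ x x -
        EdgePrecompact.QkzStripBoundaryArm.cornerObs E E.δ (x + Pi.single 0 1) (x - Pi.single 1 1) =
      Complex.I * (EdgePrecompact.QkzStripBoundaryArm.cornerObs E E.δ (x + Pi.single 0 1) x -
        EdgePrecompact.QkzStripBoundaryArm.cornerObs E E.δ x (x - Pi.single 1 1))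
    have c1 : cFace ((x + Pi.single 0 1, 1) : Site 2 × Fin 4) = x := by
      simp only [cFace, faceAt, cornerOff]; abel
    have c2 : cFace ((x + Pi.single 0 1, 2) : Site 2 × Fin 4) = x - Pi.single 1 1 := by
      simp only [cFace, faceAt, cornerOff]; abel
    have c3 : cFace ((x, 3) : Site 2 × Fin 4) = x - Pi.single 1 1 := by simp [cFace, faceAt, cornerOff]
    by_cases hxD : x ∈ meshDomain E.Ω E.δ
    · have hT : cTgt ((x, 3) : Site 2 × Fin 4) = s(x, x + Pi.single 0 1) := by
        show s(x, x + cornerUnit (3 + 1)) = _; rw [show (3 : Fin 4) + 1 = 0 by decide]; rfl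
      have key := interior (x, 3) hxD (by rw [hT]; exact hball)
      have e1 : cFace ((x, (3 : Fin 4) + 1) : Site 2 × Fin 4) = x := by
        rw [show (3 : Fin 4) + 1 = 0 by decide]; simp [cFace, faceAt, cornerOff]
      have e2 : cornerUnit ((3 : Fin 4) + 1) = Pi.single 0 1 := by rw [show (3 : Fin 4) + 1 = 0 by decide]; rfl
      have e3 : cFace ((x + Pi.single 0 1, (3 : Fin 4) + 3) : Site 2 × Fin 4) = x - Pi.single 1 1 := by
        rw [show (3 : Fin 4) + 3 = 2 by decide]; exact c2
      have e4 : cornerPartner ((x, 3) : Site 2 × Fin 4) = (x + Pi.single 0 1, 1) := by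
        show (x + cornerUnit (3 + 1), (3 : Fin 4) + 2) = _
        rw [show (3 : Fin 4) + 1 = 0 by decide, show (3 : Fin 4) + 2 = 1 by decide]; rfl
      simp only [e1, e2, e3, e4, c1, c3] at key
      exact key
    · have f3 : faceAt x 3 = x - Pi.single 1 1 := by simp [faceAt, cornerOff]
      have z0 := exterior hxD (x, 0) ⟨0, rfl⟩
      have z1 := exterior hxD (x + Pi.single 0 1, 1) ⟨0, by rw [f0, c1]⟩
      have z2 := exterior hxD (x + Pi.single 0 1, 2) ⟨3, by rw [f3, c2]⟩
      have z3 := exterior hxD (x, 3) ⟨3, rfl⟩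
      rw [c1] at z1
      rw [c2] at z2
      rw [c3] at z3
      rw [show cFace ((x, 0) : Site 2 × Fin 4) = x from f0] at z0
      rw [z0, z1, z2, z3]; ring
  · -- vertical edge `s(x, x + e₁)`, in-dart `p = (x, 0)`: `NW, NE, SE, SW = p₂, oY, p, oX`
    show EdgePrecompact.QkzStripBoundaryArm.cornerObs E E.δ (x + Pi.single 1 1) (x - Pi.single 0 1) -
        EdgePrecompact.QkzStripBoundaryArm.cornerObs E E.δ x x =
      Complex.I * (EdgePrecompact.QkzStripBoundaryArm.cornerObs E E.δ (x + Pi.single 1 1) x -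
        EdgePrecompact.QkzStripBoundaryArm.cornerObs E E.δ x (x - Pi.single 0 1))
    have c1 : cFace ((x + Pi.single 1 1, 2) : Site 2 × Fin 4) = x - Pi.single 0 1 := by
      simp only [cFace, faceAt, cornerOff]; abel
    have c2 : cFace ((x + Pi.single 1 1, 3) : Site 2 × Fin 4) = x := by
      simp only [cFace, faceAt, cornerOff]; abel
    have c3 : cFace ((x, 1) : Site 2 × Fin 4) = x - Pi.single 0 1 := by simp [cFace, faceAt, cornerOff]
    by_cases hxD : x ∈ meshDomain E.Ω E.δ
    · have key := interior (x, 0) hxD hball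
      have e1 : cFace ((x, (0 : Fin 4) + 1) : Site 2 × Fin 4) = x - Pi.single 0 1 := by
        rw [show (0 : Fin 4) + 1 = 1 by decide]; exact c3
      have e2 : cornerUnit ((0 : Fin 4) + 1) = Pi.single 1 1 := rfl
      have e3 : cFace ((x + Pi.single 1 1, (0 : Fin 4) + 3) : Site 2 × Fin 4) = x := by
        rw [show (0 : Fin 4) + 3 = 3 by decide]; exact c2
      have e4 : cornerPartner ((x, 0) : Site 2 × Fin 4) = (x + Pi.single 1 1, 2) := rfl
      have e6 : cFace ((x, 0) : Site 2 × Fin 4) = x := f0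
      simp only [e1, e2, e3, e4, c1, e6] at key
      linear_combination Complex.I * key +
        (EdgePrecompact.QkzStripBoundaryArm.cornerObs E E.δ (x + Pi.single 1 1) (x - Pi.single 0 1) -
          EdgePrecompact.QkzStripBoundaryArm.cornerObs E E.δ x x) * Complex.I_mul_I
    · have f1 : faceAt x 1 = x - Pi.single 0 1 := by simp [faceAt, cornerOff]
      have z0 := exterior hxD (x + Pi.single 1 1, 2) ⟨1, by rw [f1, c1]⟩
      have z1 := exterior hxD (x + Pi.single 1 1, 3) ⟨0, by rw [f0, c2]⟩
      have z2 := exterior hxD (x, 0) ⟨0, rfl⟩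
      have z3 := exterior hxD (x, 1) ⟨1, rfl⟩
      rw [c1] at z0
      rw [c2] at z1
      rw [c3] at z3
      rw [show cFace ((x, 0) : Site 2 × Fin 4) = x from f0] at z2
      rw [z0, z1, z2, z3]; ring

/-! ## The stub: family form -/

/-- **STUB `stub_kirchhoff`** (line `finitary-green-pairing` of crux `CoherentMorera`,
stmt-CriticalPhenomena-11388): Kirchhoff's vertex relation `E(NW) − E(SE) = i · (E(NE) − E(SW))` for the
spin-`1/3` corner observable of a family `Λ` with the crux guards over a Jordan Dobrushin domain `D`,
eventually as `δ → 0⁺`, at every lattice edge `s(x, x + eᵢ)` with medial point in a fixed compact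
`K ⊆ D`.  Proof: choose `ρ > 0` with `cthickening ρ K ⊆ D`; for admissible `0 < δ ≤ ρ / 2` the closed
`2δ`-ball about a medial point of `K` lies in `D = (Λ δ).Ω`, and `kirchhoffRel_datum` applies to the datum
`Λ δ` (mesh `(Λ δ).δ = δ`). -/
theorem stub_kirchhoff : Sig.stub_kirchhoff := by
  rintro D Λ ⟨hΩ, hΛδ, hadm⟩ K hK hKD
  obtain ⟨ρ, hρ, hρD⟩ := hK.exists_cthickening_subset_open D.isOpen hKD
  have hsmall : ∀ᶠ δ in 𝓝[>] (0:ℝ), δ ∈ Set.Ioc 0 (ρ / 2) := Ioc_mem_nhdsGT (by positivity)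
  filter_upwards [hadm, hsmall] with δ hE hδI x i hxK
  obtain ⟨-, hδρ⟩ := hδI
  have hball : closedBall (medialPoint (Λ δ).δ s(x, x + Pi.single i 1)) (2 * (Λ δ).δ) ⊆ (Λ δ).Ω := by
    rw [hΛδ, hΩ]
    intro p hp
    exact hρD (mem_cthickening_of_dist_le p _ ρ K hxK ((mem_closedBall.1 hp).trans (by linarith)))
  have key := kirchhoffRel_datum D (hΩ δ) hE x i hball
  rw [hΛδ] at key
  rw [cornerObs_eq_datum]
  exact key

end Summit.CriticalPhenomena.CardyFormulaZ2.Cruxes.CoherentMorera.FinitaryGreenPairing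

end
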